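import Summits.CriticalPhenomena.PercolationContinuityZ3.Theorems.PercNearOneGluingNoHeavyQuantLawDecStrongDuality
import Summits.CriticalPhenomena.PercolationContinuityZ3.Theorems.PercNearOneGluingNoHeavyQuantSDEC
import HarnessLib

/-!
# QUANT lane R8, Route 1 (`SingleGateConvClosed`): the CELLWISE-CERTIFICATE principle in the kernel — a product price inequality
# follows from line inequalities of the two factors plus the two mean identities as soon as it is dominated cell by cell

builds on p205010 (kernel theorem, internal audit signed; external expert review pending)

Support file (`--supports stmt-CriticalPhenomena-4575`), QUANT lane seat prim-quant-arm-2 (gen 41), rung R8 of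
`run/shared/lean/prim/quant/LADDER.md`; memo `run/shared/lean/prim/quant/prim-quant-arm-2-g41/MATRIX-SGC-G41.md` (§1, §5b).
Pure theorems, standard axioms, no sorries, no definitions.

WHY.  The dual route to `LawDec.SingleGateConvClosed` at a layer `j` (strong duality `LawDec.flowAtT_of_prices`, tree) asks, for every
price system `(α, β)` of the gated product `ν = gate (lconv M₁ M₂ μ₁ μ₂) q`, for the inequality `Σ_low α·ν ≤ Σ_abs β·ν`.  Writing the
product functional as a sum over CELLS `(i, k)` with masses `μ₁ i · μ₂ k` (`sum_test_gate_lconv`: `Σ_h f h · ν h =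
q·Σ_i Σ_k μ₁ i μ₂ k f (i+k) + (1−q)·f 0`), every certificate the lane's censuses have found (arm-2 g37's H/V transports, census-2 g62's
budgets, this seat's F** family: two-layer rows of the factors at all layers, prefix-economical pullbacks, mean tilts — 0 exact failures
on 573 adversarial price systems, memo §5) has ONE shape: a function `R k i` that is, for each row `k`, a nonnegative combination of
DEC price inequalities of `μ₁` (so `Σ_i μ₁ i · R k i ≤ 0`), a function `C i k` likewise for the columns, and two TILTS `λ k·(i − T₁)`,
`κ i·(k − T₂)` (which vanish against the mean identities), dominating the cell coefficient `q·f (i+k) + (1−q)·f 0` CELL BY CELL.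
This file proves once that such a cellwise certificate implies the product inequality (`sum_test_nonpos_of_cellCert`) and hence, via
`flowAtT_of_prices`, the flow form of DEC for the gated product (`flowAtT_gate_lconv_of_cellCert`).  Any closed-form certificate found
later lands as a pure-inequality file on top of this one.

* `LawDec.sum_test_lconv`, `LawDec.sum_test_gate`, `LawDec.sum_test_gate_lconv` — test-function sums against `lconv` / `gate`.
* `LawDec.sum_tilt_row`, `LawDec.sum_tilt_col` — the tilts integrate to zero against a product of laws with the given means.
* **`LawDec.sum_test_nonpos_of_cellCert`** — cellwise domination ⟹ `Σ_h f h · gate (lconv μ₁ μ₂) q h ≤ 0`.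
* **`LawDec.flowAtT_gate_lconv_of_cellCert`** — if every price system of the product structure at `(j, T)` admits a cellwise
  certificate, then `FlowAtT x T j (M₁+M₂) (gate (lconv M₁ M₂ μ₁ μ₂) q)`.

[this work]; strong duality `flowAtT_of_prices`: prim-quant-census-2 g54; `gate`/`lconv`: prim-quant-census-2 g53 (this lane).  LP duality
[cite: Schrijver1986, Cor 7.1f (p. 90)].  The gluing rows served [cite: KozmaNitzan2024, Conjecture 3 (p. 15)]; product measure
[cite: Grimmett1999, §1.3 p. 10].
-/

noncomputable section

namespace Summit.CriticalPhenomena.PercolationContinuityZ3.Theorems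

namespace Quant

open Finset

namespace LawDec

/-! ### Test functions against `lconv` and `gate` -/

/-- a test function summed against `lconv`: `Σ_{h ≤ M₁+M₂} f h · lconv h = Σ_{i ≤ M₁} Σ_{k ≤ M₂} μ₁ i · μ₂ k · f (i + k)`. [this work] -/
theorem sum_test_lconv (M₁ M₂ : ℕ) (μ₁ μ₂ f : ℕ → ℝ) :
    ∑ h ∈ Finset.range (M₁ + M₂ + 1), f h * lconv M₁ M₂ μ₁ μ₂ h
      = ∑ i ∈ Finset.range (M₁ + 1), ∑ k ∈ Finset.range (M₂ + 1), μ₁ i * μ₂ k * f (i + k) := by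
  simp only [lconv]
  simp_rw [Finset.mul_sum]
  rw [Finset.sum_comm]
  refine Finset.sum_congr rfl fun i hi => ?_
  rw [Finset.sum_comm]
  refine Finset.sum_congr rfl fun k hk => ?_
  rw [Finset.mem_range] at hi hk
  have ee : ∀ h : ℕ, f h * (if i + k = h then μ₁ i * μ₂ k else 0)
      = if i + k = h then μ₁ i * μ₂ k * f (i + k) else 0 := by
    intro h
    split_ifs with hik
    · rw [← hik]; ring
    · rw [mul_zero]
  simp_rw [ee]
  rw [Finset.sum_ite_eq (Finset.range (M₁ + M₂ + 1)) (i + k), if_pos (Finset.mem_range.2 (by omega))]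

/-- a test function summed against `gate`: `Σ_{h ≤ M} f h · gate μ q h = q·Σ_{h ≤ M} f h · μ h + (1−q)·f 0`. [this work] -/
theorem sum_test_gate (μ f : ℕ → ℝ) (q : ℝ) (M : ℕ) :
    ∑ h ∈ Finset.range (M + 1), f h * gate μ q h = q * ∑ h ∈ Finset.range (M + 1), f h * μ h + (1 - q) * f 0 := by
  simp only [gate]
  have e : ∀ h : ℕ, f h * (q * μ h + (if h = 0 then 1 - q else 0))
      = q * (f h * μ h) + (if h = 0 then (1 - q) * f 0 else 0) := by
    intro h
    split_ifs with h0
    · rw [h0]; ring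
    · ring
  simp_rw [e]
  rw [Finset.sum_add_distrib, ← Finset.mul_sum, Finset.sum_ite_eq' (Finset.range (M + 1)) 0,
    if_pos (Finset.mem_range.2 (Nat.succ_pos M))]

/-- a test function summed against the gated product: `Σ_h f h · gate (lconv μ₁ μ₂) q h = q·Σ_i Σ_k μ₁ i μ₂ k f (i+k) + (1−q)·f 0`. [this work] -/
theorem sum_test_gate_lconv (M₁ M₂ : ℕ) (μ₁ μ₂ f : ℕ → ℝ) (q : ℝ) :
    ∑ h ∈ Finset.range (M₁ + M₂ + 1), f h * gate (lconv M₁ M₂ μ₁ μ₂) q h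
      = q * ∑ i ∈ Finset.range (M₁ + 1), ∑ k ∈ Finset.range (M₂ + 1), μ₁ i * μ₂ k * f (i + k) + (1 - q) * f 0 := by
  rw [sum_test_gate, sum_test_lconv]

/-! ### Tilts vanish against laws with the prescribed means -/

/-- row tilts `λ k·(i − T₁)` integrate to zero when `μ₁` has mean `T₁` and mass `1`. [this work] -/
theorem sum_tilt_row (M₁ M₂ : ℕ) (μ₁ μ₂ lam : ℕ → ℝ) (T₁ : ℝ)
    (hμ1 : ∑ i ∈ Finset.range (M₁ + 1), μ₁ i = 1) (hT1 : ∑ i ∈ Finset.range (M₁ + 1), (i : ℝ) * μ₁ i = T₁) :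
    ∑ i ∈ Finset.range (M₁ + 1), ∑ k ∈ Finset.range (M₂ + 1), μ₁ i * μ₂ k * (lam k * ((i : ℝ) - T₁)) = 0 := by
  rw [Finset.sum_comm]
  refine Finset.sum_eq_zero fun k _ => ?_
  have e : ∀ i : ℕ, μ₁ i * μ₂ k * (lam k * ((i : ℝ) - T₁)) = μ₂ k * lam k * ((i : ℝ) * μ₁ i - T₁ * μ₁ i) := fun i => by ring
  simp_rw [e]
  rw [← Finset.mul_sum, Finset.sum_sub_distrib, ← Finset.mul_sum, hT1, hμ1, mul_one, sub_self, mul_zero]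

/-- column tilts `κ i·(k − T₂)` integrate to zero when `μ₂` has mean `T₂` and mass `1`. [this work] -/
theorem sum_tilt_col (M₁ M₂ : ℕ) (μ₁ μ₂ kap : ℕ → ℝ) (T₂ : ℝ)
    (hμ2 : ∑ k ∈ Finset.range (M₂ + 1), μ₂ k = 1) (hT2 : ∑ k ∈ Finset.range (M₂ + 1), (k : ℝ) * μ₂ k = T₂) :
    ∑ i ∈ Finset.range (M₁ + 1), ∑ k ∈ Finset.range (M₂ + 1), μ₁ i * μ₂ k * (kap i * ((k : ℝ) - T₂)) = 0 := by
  refine Finset.sum_eq_zero fun i _ => ?_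
  have e : ∀ k : ℕ, μ₁ i * μ₂ k * (kap i * ((k : ℝ) - T₂)) = μ₁ i * kap i * ((k : ℝ) * μ₂ k - T₂ * μ₂ k) := fun k => by ring
  simp_rw [e]
  rw [← Finset.mul_sum, Finset.sum_sub_distrib, ← Finset.mul_sum, hT2, hμ2, mul_one, sub_self, mul_zero]

/-! ### The cellwise-certificate principle -/

/-- **CELLWISE DOMINATION ⟹ THE PRODUCT FUNCTIONAL IS NONPOSITIVE.**  Let `μ₁ ≥ 0` have mass `1` and mean `T₁` on `{0..M₁}`, `μ₂ ≥ 0`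
mass `1` and mean `T₂` on `{0..M₂}`, `0 ≤ q`.  Suppose row certificates `R k ·` (`Σ_i μ₁ i · R k i ≤ 0` for every `k ≤ M₂` — e.g. nonnegative
combinations of DEC price inequalities of `gate μ₁ q` written per unit of `μ₁`-mass), column certificates `C i ·` (`Σ_k μ₂ k · C i k ≤ 0`),
and tilts `lam`, `kap` dominate the test function `f` cell by cell:
`q·f (i+k) + (1−q)·f 0 ≤ R k i + C i k + lam k·(i − T₁) + kap i·(k − T₂)` for all `i ≤ M₁`, `k ≤ M₂`.
Then `Σ_{h ≤ M₁+M₂} f h · gate (lconv M₁ M₂ μ₁ μ₂) q h ≤ 0`. [this work] -/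
theorem sum_test_nonpos_of_cellCert (M₁ M₂ : ℕ) (μ₁ μ₂ : ℕ → ℝ) (q T₁ T₂ : ℝ) (f : ℕ → ℝ)
    (R C : ℕ → ℕ → ℝ) (lam kap : ℕ → ℝ)
    (h10 : ∀ i, 0 ≤ μ₁ i) (h20 : ∀ k, 0 ≤ μ₂ k)
    (hμ1 : ∑ i ∈ Finset.range (M₁ + 1), μ₁ i = 1) (hμ2 : ∑ k ∈ Finset.range (M₂ + 1), μ₂ k = 1)
    (hT1 : ∑ i ∈ Finset.range (M₁ + 1), (i : ℝ) * μ₁ i = T₁) (hT2 : ∑ k ∈ Finset.range (M₂ + 1), (k : ℝ) * μ₂ k = T₂)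
    (hrow : ∀ k, k ≤ M₂ → ∑ i ∈ Finset.range (M₁ + 1), μ₁ i * R k i ≤ 0)
    (hcol : ∀ i, i ≤ M₁ → ∑ k ∈ Finset.range (M₂ + 1), μ₂ k * C i k ≤ 0)
    (hcell : ∀ i k, i ≤ M₁ → k ≤ M₂ →
      q * f (i + k) + (1 - q) * f 0 ≤ R k i + C i k + lam k * ((i : ℝ) - T₁) + kap i * ((k : ℝ) - T₂)) :
    ∑ h ∈ Finset.range (M₁ + M₂ + 1), f h * gate (lconv M₁ M₂ μ₁ μ₂) q h ≤ 0 := by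
  rw [sum_test_gate_lconv]
  -- distribute the constant `(1 - q)·f 0` over the cells (total mass `1`)
  have hmass : ∑ i ∈ Finset.range (M₁ + 1), ∑ k ∈ Finset.range (M₂ + 1), μ₁ i * μ₂ k = 1 := by
    have e : ∀ i : ℕ, ∑ k ∈ Finset.range (M₂ + 1), μ₁ i * μ₂ k = μ₁ i := by
      intro i; rw [← Finset.mul_sum, hμ2, mul_one]
    rw [Finset.sum_congr rfl fun i _ => e i, hμ1]
  have hconst : (1 - q) * f 0 = ∑ i ∈ Finset.range (M₁ + 1), ∑ k ∈ Finset.range (M₂ + 1), μ₁ i * μ₂ k * ((1 - q) * f 0) := by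
    have e : ∀ i : ℕ, ∑ k ∈ Finset.range (M₂ + 1), μ₁ i * μ₂ k * ((1 - q) * f 0)
        = (∑ k ∈ Finset.range (M₂ + 1), μ₁ i * μ₂ k) * ((1 - q) * f 0) := by
      intro i; rw [Finset.sum_mul]
    simp_rw [e]
    rw [← Finset.sum_mul, hmass, one_mul]
  -- the cellwise bound, integrated against the nonnegative cell masses
  have hle : q * ∑ i ∈ Finset.range (M₁ + 1), ∑ k ∈ Finset.range (M₂ + 1), μ₁ i * μ₂ k * f (i + k) + (1 - q) * f 0
      ≤ ∑ i ∈ Finset.range (M₁ + 1), ∑ k ∈ Finset.range (M₂ + 1),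
          μ₁ i * μ₂ k * (R k i + C i k + lam k * ((i : ℝ) - T₁) + kap i * ((k : ℝ) - T₂)) := by
    rw [hconst, Finset.mul_sum, ← Finset.sum_add_distrib]
    refine Finset.sum_le_sum fun i hi => ?_
    rw [Finset.mul_sum, ← Finset.sum_add_distrib]
    refine Finset.sum_le_sum fun k hk => ?_
    have hik := hcell i k (Nat.le_of_lt_succ (Finset.mem_range.1 hi)) (Nat.le_of_lt_succ (Finset.mem_range.1 hk))
    have hm : 0 ≤ μ₁ i * μ₂ k := mul_nonneg (h10 i) (h20 k)
    have : q * (μ₁ i * μ₂ k * f (i + k)) + μ₁ i * μ₂ k * ((1 - q) * f 0)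
        = μ₁ i * μ₂ k * (q * f (i + k) + (1 - q) * f 0) := by ring
    rw [this]
    exact mul_le_mul_of_nonneg_left hik hm
  refine hle.trans ?_
  -- split the right-hand side into rows, columns and the two tilts
  have esplit : ∑ i ∈ Finset.range (M₁ + 1), ∑ k ∈ Finset.range (M₂ + 1),
      μ₁ i * μ₂ k * (R k i + C i k + lam k * ((i : ℝ) - T₁) + kap i * ((k : ℝ) - T₂))
      = (∑ i ∈ Finset.range (M₁ + 1), ∑ k ∈ Finset.range (M₂ + 1), μ₁ i * μ₂ k * R k i)
        + (∑ i ∈ Finset.range (M₁ + 1), ∑ k ∈ Finset.range (M₂ + 1), μ₁ i * μ₂ k * C i k)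
        + (∑ i ∈ Finset.range (M₁ + 1), ∑ k ∈ Finset.range (M₂ + 1), μ₁ i * μ₂ k * (lam k * ((i : ℝ) - T₁)))
        + (∑ i ∈ Finset.range (M₁ + 1), ∑ k ∈ Finset.range (M₂ + 1), μ₁ i * μ₂ k * (kap i * ((k : ℝ) - T₂))) := by
    rw [← Finset.sum_add_distrib, ← Finset.sum_add_distrib, ← Finset.sum_add_distrib]
    refine Finset.sum_congr rfl fun i _ => ?_
    rw [← Finset.sum_add_distrib, ← Finset.sum_add_distrib, ← Finset.sum_add_distrib]
    refine Finset.sum_congr rfl fun k _ => ?_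
    ring
  rw [esplit, sum_tilt_row M₁ M₂ μ₁ μ₂ lam T₁ hμ1 hT1, sum_tilt_col M₁ M₂ μ₁ μ₂ kap T₂ hμ2 hT2, add_zero, add_zero]
  -- rows: Σ_k μ₂ k · (Σ_i μ₁ i R k i) ≤ 0 ; columns likewise
  have hR : ∑ i ∈ Finset.range (M₁ + 1), ∑ k ∈ Finset.range (M₂ + 1), μ₁ i * μ₂ k * R k i ≤ 0 := by
    rw [Finset.sum_comm]
    refine Finset.sum_nonpos fun k hk => ?_
    have e : ∀ i : ℕ, μ₁ i * μ₂ k * R k i = μ₂ k * (μ₁ i * R k i) := fun i => by ring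
    simp_rw [e]
    rw [← Finset.mul_sum]
    exact mul_nonpos_of_nonneg_of_nonpos (h20 k) (hrow k (Nat.le_of_lt_succ (Finset.mem_range.1 hk)))
  have hC : ∑ i ∈ Finset.range (M₁ + 1), ∑ k ∈ Finset.range (M₂ + 1), μ₁ i * μ₂ k * C i k ≤ 0 := by
    refine Finset.sum_nonpos fun i hi => ?_
    have e : ∀ k : ℕ, μ₁ i * μ₂ k * C i k = μ₁ i * (μ₂ k * C i k) := fun k => by ring
    simp_rw [e]
    rw [← Finset.mul_sum]
    exact mul_nonpos_of_nonneg_of_nonpos (h10 i) (hcol i (Nat.le_of_lt_succ (Finset.mem_range.1 hi)))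
  linarith

/-- **THE CELLWISE-CERTIFICATE PRINCIPLE FOR THE GATED PRODUCT** (the kernel anchor of the dual route to `SingleGateConvClosed`,
memo MATRIX-SGC-G41 §5b).  Let `μ₁, μ₂` be probability laws on `{0..M₁}`, `{0..M₂}` with means `T₁, T₂`, `0 < x < 1`, `0 ≤ q`, a layer
`j < M₁ + M₂` and a target `T`.  If EVERY price system `(α, β)` of the product structure at `(j, T)` (`β ≥ 0`; `α l ≤ usage(l,h)·β h` for
lows `l ≤ j`, `2l < T` and compatible absorbers `h ≤ M₁+M₂`) admits a cellwise certificate — row certificates `R` with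
`Σ_i μ₁ i · R k i ≤ 0`, column certificates `C` with `Σ_k μ₂ k · C i k ≤ 0`, tilts `lam`, `kap`, dominating
`q·f (i+k) + (1−q)·f 0` with `f h = α h` on the lows (`h ≤ j`, `2h < T`) and `f h = −β h` elsewhere — then the gated product has the
flow form of DEC: `FlowAtT x T j (M₁+M₂) (gate (lconv M₁ M₂ μ₁ μ₂) q)`.  (Strong duality `flowAtT_of_prices` + `sum_test_nonpos_of_cellCert`.)
[this work] -/
theorem flowAtT_gate_lconv_of_cellCert (x T q : ℝ) (j M₁ M₂ : ℕ) (μ₁ μ₂ : ℕ → ℝ) (T₁ T₂ : ℝ)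
    (h10 : ∀ i, 0 ≤ μ₁ i) (h20 : ∀ k, 0 ≤ μ₂ k)
    (hμ1 : ∑ i ∈ Finset.range (M₁ + 1), μ₁ i = 1) (hμ2 : ∑ k ∈ Finset.range (M₂ + 1), μ₂ k = 1)
    (hT1 : ∑ i ∈ Finset.range (M₁ + 1), (i : ℝ) * μ₁ i = T₁) (hT2 : ∑ k ∈ Finset.range (M₂ + 1), (k : ℝ) * μ₂ k = T₂)
    (hj : j < M₁ + M₂)
    (hcert : ∀ α β : ℕ → ℝ, (∀ h, 0 ≤ β h) →
      (∀ l h, l ≤ j → 2 * (l : ℝ) < T → h ≤ M₁ + M₂ → (j + 1 ≤ h ∨ T < (l : ℝ) + h) →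
        α l ≤ usage x T j l h * β h) →
      ∃ (R C : ℕ → ℕ → ℝ) (lam kap : ℕ → ℝ),
        (∀ k, k ≤ M₂ → ∑ i ∈ Finset.range (M₁ + 1), μ₁ i * R k i ≤ 0) ∧
        (∀ i, i ≤ M₁ → ∑ k ∈ Finset.range (M₂ + 1), μ₂ k * C i k ≤ 0) ∧
        (∀ i k, i ≤ M₁ → k ≤ M₂ →
          q * (if i + k ≤ j ∧ 2 * ((i + k : ℕ) : ℝ) < T then α (i + k) else -β (i + k))
            + (1 - q) * (if 0 ≤ j ∧ 2 * ((0 : ℕ) : ℝ) < T then α 0 else -β 0)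
          ≤ R k i + C i k + lam k * ((i : ℝ) - T₁) + kap i * ((k : ℝ) - T₂))) :
    FlowAtT x T j (M₁ + M₂) (gate (lconv M₁ M₂ μ₁ μ₂) q) := by
  classical
  refine flowAtT_of_prices x T j (M₁ + M₂) _ fun α β hβ hαβ => ?_
  obtain ⟨R, C, lam, kap, hrow, hcol, hcell⟩ := hcert α β hβ hαβ
  set ν := gate (lconv M₁ M₂ μ₁ μ₂) q with hν
  set f : ℕ → ℝ := fun h => if h ≤ j ∧ 2 * (h : ℝ) < T then α h else -β h with hf
  have key : ∑ h ∈ Finset.range (M₁ + M₂ + 1), f h * ν h ≤ 0 := by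
    refine sum_test_nonpos_of_cellCert M₁ M₂ μ₁ μ₂ q T₁ T₂ f R C lam kap h10 h20 hμ1 hμ2 hT1 hT2 hrow hcol ?_
    intro i k hi hk
    have h0 : f 0 = (if 0 ≤ j ∧ 2 * ((0 : ℕ) : ℝ) < T then α 0 else -β 0) := by simp only [hf]
    have hik : f (i + k) = (if i + k ≤ j ∧ 2 * ((i + k : ℕ) : ℝ) < T then α (i + k) else -β (i + k)) := by
      simp only [hf]
    rw [hik, h0]
    exact hcell i k hi hk
  -- rewrite the two sides of the price inequality as one sum of `f h · ν h`
  have hsplit : ∀ h : ℕ, f h * ν h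
      = (if h ≤ j ∧ 2 * (h : ℝ) < T then α h * ν h else 0) - (if h ≤ j ∧ 2 * (h : ℝ) < T then 0 else β h * ν h) := by
    intro h
    simp only [hf]
    split_ifs <;> ring
  have hsum : ∑ h ∈ Finset.range (M₁ + M₂ + 1), f h * ν h
      = ∑ h ∈ Finset.range (M₁ + M₂ + 1), (if h ≤ j ∧ 2 * (h : ℝ) < T then α h * ν h else 0)
        - ∑ h ∈ Finset.range (M₁ + M₂ + 1), (if h ≤ j ∧ 2 * (h : ℝ) < T then 0 else β h * ν h) := by
    rw [← Finset.sum_sub_distrib]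
    exact Finset.sum_congr rfl fun h _ => hsplit h
  -- the low side lives on `range (j+1) ⊆ range (M₁+M₂+1)`
  have hlow : ∑ l ∈ Finset.range (j + 1), (if 2 * (l : ℝ) < T then α l * ν l else 0)
      = ∑ h ∈ Finset.range (M₁ + M₂ + 1), (if h ≤ j ∧ 2 * (h : ℝ) < T then α h * ν h else 0) := by
    have hsub : Finset.range (j + 1) ⊆ Finset.range (M₁ + M₂ + 1) :=
      fun h hh => Finset.mem_range.2 (lt_of_lt_of_le (Finset.mem_range.1 hh) (Nat.succ_le_succ hj.le))
    rw [← Finset.sum_subset hsub (fun h hM hj' => by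
      have hjlt : ¬ (h ≤ j ∧ 2 * (h : ℝ) < T) := fun hc => hj' (Finset.mem_range.2 (Nat.lt_succ_of_le hc.1))
      rw [if_neg hjlt])]
    refine Finset.sum_congr rfl fun h hh => ?_
    have hle : h ≤ j := Nat.le_of_lt_succ (Finset.mem_range.1 hh)
    by_cases hlt : 2 * (h : ℝ) < T
    · rw [if_pos hlt, if_pos ⟨hle, hlt⟩]
    · rw [if_neg hlt, if_neg (fun hc => hlt hc.2)]
  rw [hlow]
  linarith [key, hsum]

end LawDec

end Quant

end Summit.CriticalPhenomena.PercolationContinuityZ3.Theorems
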